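import Literature.RingTheory.MvPolynomial.HilbertFunctionPolynomialExtension
import Mathlib.Logic.Equiv.Fin.Rotate
import HarnessLib

/-!
# The Hilbert function of a polynomial extension in several variables appended at the end:
# `H(A[T_1, …, T_s]) = H^{(s)}(A)` (Cossart–Jannsen–Saito 2020, Lemma 2.37 (1) / (2.6); HIO (21.7))

Topic: `Literature/RingTheory/MvPolynomial`. Sequel of `HilbertFunctionPolynomialExtension.lean`, which
proves the ONE-variable formula `H(S'/I S')(d) = Σ_{i ≤ d} H(S/I)(i)` for the new variable placed IN FRONT
(`S = k[X_1, …, X_n] ↪ S' = k[X_0, …, X_n]`, `rename Fin.succ`). The named fact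
`HerrmannIkedaOrbanz1988_cor_21_11` (`HilbertSamuel/NormalConeFibreIdeal.lean`; the Hironaka–Grothendieck
isomorphism `(gr_𝔭(R) ⊗ k)[T_1, …, T_r] ≅ gr_𝔪(R)`) extends ideals along `k[X_1, …, X_m] ↪ k[X_1, …, X_m, T_1, …, T_s]`
with the new variables AT THE END (`rename (Fin.castAdd s)`), `s` of them. This file supplies that form:

* `idealDegree_map_rename_equiv`, `finrank_idealDegree_map_rename_equiv`, **`hilbertFunQuot_map_rename_equiv`** (plumbing lemmas private) —
  renaming the variables by a permutation `e : Fin n ≃ Fin n` does not change the Hilbert function of `S/I`;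
* **`hilbertFunQuot_map_rename_castSucc`** — the one-variable formula with the new variable
  at the END (`Fin.castSucc = (finRotate _)⁻¹ ∘ Fin.succ`);
* **`hilbertFunQuot_map_rename_castAdd`** — `H(S[T_1, …, T_s]/I S[T])(d) = H^{(s)}(S/I)(d)` (`iterPSum s`), by
  induction on `s` (`Fin.castAdd (s+1) = Fin.castSucc ∘ Fin.castAdd s`);
  (the convolution form `Σ_{i ≤ d} H(S/I)(i) · #Mon_{d−i}(s)` follows with `sum_mul_iterPSum_Phi` of
  `HilbertSamuel/NormalFlatnessHilbertFunction.lean`, not imported here).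

This is the graded computation behind CJS Lemma 2.37 (1) («`H^{(0)}(𝒪_{X',x'}) = H^{(d)}(𝒪_{X,x})`» via
`gr_{𝔪'} ≅ gr_𝔪 ⊗ k[T_1, …, T_d]`, (2.6)) for `d` variables at once. Written for the cell res-hironaka (HIRONAKA-L,
librarian seat res-D-lib-1; consumer: the discharge of `HerrmannIkedaOrbanz1988_cor_21_11`). AI-written; AI review
is weaker than expert review.

## References

* V. Cossart, U. Jannsen, S. Saito, *Desingularization: Invariants and Strategy*, LNM 2270 (2020), Lemma 2.27 (2),
  (2.6), Lemma 2.37 (1). [CossartJannsenSaito2020]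
* M. Herrmann, S. Ikeda, U. Orbanz, *Equimultiplicity and Blowing up* (1988), (21.7) (the map
  `G(I,x) : (G(I,R) ⊗ R/L)[T_1, …, T_r] → G(L,R)`). [HerrmannIkedaOrbanz1988]
-/

noncomputable section

open MvPolynomial Module
open Literature.RingTheory.HilbertSamuel

namespace Literature.RingTheory.MvPolynomial

variable {K : Type*} [Field K]

/-! ## Renaming by a bijection does not change the Hilbert function -/

section RenameEquiv

variable {σ τ : Type*}

/-- `rename` along a bijection is surjective. [folklore] -/
private theorem rename_surjective_of_equiv (e : σ ≃ τ) :
    Function.Surjective (rename e : MvPolynomial σ K →ₐ[K] MvPolynomial τ K) := fun p =>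
  ⟨rename e.symm p, by rw [rename_rename, Equiv.self_comp_symm, rename_id, AlgHom.id_apply]⟩

/-- **The degree-`d` part of the renamed ideal is the renamed degree-`d` part** (`e` a bijection of
the variables) — the graded pieces of `S/I` do not depend on the naming of the variables.
[cite: CossartJannsenSaito2020, Lemma 2.27 (2)] -/
theorem idealDegree_map_rename_equiv (e : σ ≃ τ) (I : Ideal (MvPolynomial σ K)) (d : ℕ) :
    idealDegree (I.map ((rename e : MvPolynomial σ K →ₐ[K] MvPolynomial τ K) :
      MvPolynomial σ K →+* MvPolynomial τ K)) d =
      (idealDegree I d).map (rename e : MvPolynomial σ K →ₐ[K] MvPolynomial τ K).toLinearMap := by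
  ext f
  rw [mem_idealDegree, Submodule.mem_map]
  constructor
  · rintro ⟨hf, hfd⟩
    obtain ⟨g, hg, rfl⟩ := (Ideal.mem_map_iff_of_surjective _ (rename_surjective_of_equiv e)).mp hf
    exact ⟨g, mem_idealDegree.mpr ⟨hg, (IsHomogeneous.rename_isHomogeneous_iff e.injective).mp hfd⟩, rfl⟩
  · rintro ⟨g, hg, rfl⟩
    obtain ⟨hgI, hgd⟩ := mem_idealDegree.mp hg
    exact ⟨Ideal.mem_map_of_mem _ hgI, hgd.rename_isHomogeneous⟩

/-- Hence `dim_k (I·k[X_e])_d = dim_k I_d`. [cite: CossartJannsenSaito2020, Lemma 2.27 (2)] -/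
theorem finrank_idealDegree_map_rename_equiv (e : σ ≃ τ) (I : Ideal (MvPolynomial σ K)) (d : ℕ) :
    finrank K (idealDegree (I.map ((rename e : MvPolynomial σ K →ₐ[K] MvPolynomial τ K) :
      MvPolynomial σ K →+* MvPolynomial τ K)) d) = finrank K (idealDegree I d) := by
  rw [idealDegree_map_rename_equiv]
  exact (LinearEquiv.finrank_eq (Submodule.equivMapOfInjective _
    (rename_injective _ e.injective) (idealDegree I d))).symm

/-- **The Hilbert function of `S/I` is invariant under permutations of the variables.** [cite: CossartJannsenSaito2020, Lemma 2.27 (2)] -/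
theorem hilbertFunQuot_map_rename_equiv {n : ℕ} (e : Fin n ≃ Fin n) (I : Ideal (MvPolynomial (Fin n) K))
    (d : ℕ) :
    hilbertFunQuot K n (I.map ((rename e : MvPolynomial (Fin n) K →ₐ[K] MvPolynomial (Fin n) K) :
      MvPolynomial (Fin n) K →+* MvPolynomial (Fin n) K)) d = hilbertFunQuot K n I d := by
  unfold hilbertFunQuot
  rw [finrank_idealDegree_map_rename_equiv]

end RenameEquiv

/-! ## One new variable at the end -/

section CastSucc

variable {n : ℕ}

/-- `Fin.succ = finRotate ∘ Fin.castSucc` on `Fin n → Fin (n+1)`. [folklore] -/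
private theorem finRotate_castSucc_eq_succ (i : Fin n) : finRotate (n + 1) (Fin.castSucc i) = i.succ := by
  have h := finRotate_of_lt (n := n) i.2
  exact Fin.ext (by rw [show Fin.castSucc i = ⟨(i : ℕ), i.2.trans_le n.le_succ⟩ from rfl, h]; rfl)

/-- `Fin.castSucc = (finRotate)⁻¹ ∘ Fin.succ`. [folklore] -/
private theorem finRotate_symm_comp_succ :
    ((finRotate (n + 1)).symm ∘ Fin.succ : Fin n → Fin (n + 1)) = Fin.castSucc := by
  funext i
  rw [Function.comp_apply, Equiv.symm_apply_eq, finRotate_castSucc_eq_succ]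

/-- `rename Fin.castSucc = rename (finRotate⁻¹) ∘ rename Fin.succ` as ring homomorphisms. [folklore] -/
private theorem rename_castSucc_eq :
    ((rename Fin.castSucc : MvPolynomial (Fin n) K →ₐ[K] MvPolynomial (Fin (n + 1)) K) :
      MvPolynomial (Fin n) K →+* MvPolynomial (Fin (n + 1)) K) =
      ((rename (finRotate (n + 1)).symm : MvPolynomial (Fin (n + 1)) K →ₐ[K] MvPolynomial (Fin (n + 1)) K) :
        MvPolynomial (Fin (n + 1)) K →+* MvPolynomial (Fin (n + 1)) K).comp
      ((rename Fin.succ : MvPolynomial (Fin n) K →ₐ[K] MvPolynomial (Fin (n + 1)) K) :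
        MvPolynomial (Fin n) K →+* MvPolynomial (Fin (n + 1)) K) := by
  refine RingHom.ext fun p => ?_
  change rename Fin.castSucc p = rename (finRotate (n + 1)).symm (rename Fin.succ p)
  rw [rename_rename, finRotate_symm_comp_succ]

/-- **`H(S[T]/I S[T])(d) = Σ_{i ≤ d} H(S/I)(i)` with the new variable at the END** (`S = k[X_1, …, X_n] ↪ k[X_1, …, X_n, T]`,
`rename Fin.castSucc`). [cite: CossartJannsenSaito2020, Lemma 2.27 (2)] -/
theorem hilbertFunQuot_map_rename_castSucc (I : Ideal (MvPolynomial (Fin n) K)) (d : ℕ) :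
    hilbertFunQuot K (n + 1) (I.map ((rename Fin.castSucc : MvPolynomial (Fin n) K →ₐ[K] MvPolynomial (Fin (n + 1)) K) :
      MvPolynomial (Fin n) K →+* MvPolynomial (Fin (n + 1)) K)) d =
      ∑ i ∈ Finset.range (d + 1), hilbertFunQuot K n I i := by
  rw [rename_castSucc_eq, ← Ideal.map_map, hilbertFunQuot_map_rename_equiv, hilbertFunQuot_map_rename_succ]

end CastSucc

/-! ## `s` new variables at the end: `H(S[T_1, …, T_s]/I S[T])(d) = H^{(s)}(S/I)(d)` -/

section CastAdd

variable {n : ℕ}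

/-- `Fin.castAdd 0` is the identity. [folklore] -/
private theorem castAdd_zero_eq_id : (Fin.castAdd 0 : Fin n → Fin (n + 0)) = id :=
  funext fun _ => Fin.ext rfl

/-- `Fin.castAdd (s+1) = Fin.castSucc ∘ Fin.castAdd s`. [folklore] -/
private theorem castAdd_succ_eq_comp (s : ℕ) :
    (Fin.castAdd (s + 1) : Fin n → Fin (n + (s + 1))) = Fin.castSucc ∘ Fin.castAdd s :=
  funext fun i => (Fin.castSucc_castAdd i).symm

/-- **`H(S[T_1, …, T_s]/I S[T])(d) = H^{(s)}(S/I)(d)`** — the Hilbert function of the polynomial extension in `s`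
variables is the `s`-fold sum function (CJS Lemma 2.37 (1): `gr_{𝔪'} ≅ gr_𝔪 ⊗ k[T_1, …, T_d]` gives
`H^{(0)}(𝒪_{X',x'}) = H^{(d)}(𝒪_{X,x})`). [cite: CossartJannsenSaito2020, Lemma 2.37 (1) and Lemma 2.27 (2), (2.6)] -/
theorem hilbertFunQuot_map_rename_castAdd (I : Ideal (MvPolynomial (Fin n) K)) :
    ∀ (s d : ℕ), hilbertFunQuot K (n + s)
      (I.map ((rename (Fin.castAdd s) : MvPolynomial (Fin n) K →ₐ[K] MvPolynomial (Fin (n + s)) K) :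
        MvPolynomial (Fin n) K →+* MvPolynomial (Fin (n + s)) K)) d = iterPSum s (hilbertFunQuot K n I) d
  | 0, d => by
    rw [iterPSum_zero, castAdd_zero_eq_id]
    change hilbertFunQuot K n (I.map ((rename id : MvPolynomial (Fin n) K →ₐ[K] MvPolynomial (Fin n) K) :
      MvPolynomial (Fin n) K →+* MvPolynomial (Fin n) K)) d = hilbertFunQuot K n I d
    have : ((rename id : MvPolynomial (Fin n) K →ₐ[K] MvPolynomial (Fin n) K) :
        MvPolynomial (Fin n) K →+* MvPolynomial (Fin n) K) = RingHom.id _ :=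
      RingHom.ext fun p => by change rename id p = p; rw [rename_id, AlgHom.id_apply]
    rw [this, Ideal.map_id]
  | s + 1, d => by
    have hcomp : ((rename (Fin.castAdd (s + 1)) : MvPolynomial (Fin n) K →ₐ[K] MvPolynomial (Fin (n + (s + 1))) K) :
        MvPolynomial (Fin n) K →+* MvPolynomial (Fin (n + (s + 1))) K) =
        ((rename Fin.castSucc : MvPolynomial (Fin (n + s)) K →ₐ[K] MvPolynomial (Fin (n + s + 1)) K) :
          MvPolynomial (Fin (n + s)) K →+* MvPolynomial (Fin (n + s + 1)) K).comp
        ((rename (Fin.castAdd s) : MvPolynomial (Fin n) K →ₐ[K] MvPolynomial (Fin (n + s)) K) :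
          MvPolynomial (Fin n) K →+* MvPolynomial (Fin (n + s)) K) := by
      refine RingHom.ext fun p => ?_
      change rename (Fin.castAdd (s + 1)) p = rename Fin.castSucc (rename (Fin.castAdd s) p)
      rw [rename_rename, castAdd_succ_eq_comp]
    rw [hcomp, ← Ideal.map_map, iterPSum_succ, psum_apply]
    change hilbertFunQuot K (n + s + 1) _ d = _
    rw [hilbertFunQuot_map_rename_castSucc]
    exact Finset.sum_congr rfl fun i _ => hilbertFunQuot_map_rename_castAdd I s i

end CastAdd

end Literature.RingTheory.MvPolynomial

end
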